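import Summits.HodgeConjecture.CorCM.Census.NondegenerateReduction

/-!
# Residual reduction tools: base-change stability of the target lattice, orbit representatives, and the ORDER-FOUR TRICK

COR-CM (cell `pub-hodgecm2`), count-neutral kernel combinatorics by the binder seat b09 (gen 38; lane TWO-ADIC SPLITTING +
NONDEGENERATE REDUCTION, part J), sequel of part A `Census/NondegenerateReduction.lean`; the tools every application of the meta-theorem
(`Census/NondegenerateSplitting.lean`) uses to discharge its one substantive hypothesis — the reduction of the RESIDUAL types onto the base changes
of the base type `T₀`, up to a power of `2`, modulo the TARGET LATTICE
`𝓣(S, T₀) = (ℤ⟨pairs⟩ + ℤ⟨base changes of S⟩) + ℤ⟨[T₀·Q⁻¹] : Q⟩` — written out as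
`(span pairSet ⊔ span (translates S)) ⊔ span (range fun Q => single (rt Q T₀) 1)` throughout (no definition).  Theorems only: no definition,
no `decide`, no certificate, no named fact, no `sorry`.
HONEST FRAMING: `HC_CM` is NOT proved, here or anywhere in the tree; nothing here is a period or a headline.

* §1 **Stability**: `𝓣(S, T₀)` contains the pairs and the base changes of `[T₀]` and is stable under every base change `y ↦ y·Q⁻¹`
  (`mapDomain_rt_mem_target`); hence a reduction `2^k[Ψ] ∈ 𝓣` transports to the whole block of `Ψ` (`smul_single_rt_mem_target`), and it suffices
  to reduce ONE representative per residual block (`reduction_of_representatives`).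
* §2 **THE ORDER-FOUR TRICK** (`two_smul_single_mem_of_single_add_mem`, `…_of_single_sub_mem`): if `h² = c` and `[Ψ] ± [Ψ·h⁻¹] ∈ 𝓣`, then
  `2[Ψ] ∈ 𝓣` — apply the base change along `h` once more: `Ψ·h⁻² = Ψ·c⁻¹ = Ψ̄` and `[Ψ] + [Ψ̄]` is a pair.  In a dicyclic-type group EVERY element
  off the cyclic index-two subgroup squares to `c`, so every closing relation pairing a residual type with one of its off-subgroup base changes
  is worth a factor `2` exactly (part H `Census/QuaternionEightLaw.lean` is the case `Q₈`: `(xa 1)² = c`); with `[Ψ] ± [Ψ·h⁻¹]` known only up to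
  `2^k` the trick gives `2^{k+1}` (`pow_succ_smul_single_mem_of_smul_add_mem`).

## References
* [Pohlmann1968] H. Pohlmann, Algebraic cycles on abelian varieties of complex multiplication type, Ann. of Math. 88 (1968), Thm 1.
-/

namespace Summit.HodgeConjecture.CorCM.Census.Nondegenerate

open Finset
open Summit.HodgeConjecture.CorCM.Prior.AllgGroup.RfwfAllgGroup
open Summit.HodgeConjecture.CorCM.Census.BlockParity
open Summit.HodgeConjecture.CorCM.Census.Coinvariant
open Summit.HodgeConjecture.CorCM.Census.TwistGeneration

noncomputable section

variable {G : Type*} [Group G] [Fintype G] [DecidableEq G] (c : G) (S : Finset (CMF G c →₀ ℤ)) (T₀ : CMF G c)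

/-! ## §1 The target lattice: members and base-change stability -/

/-- Base changes of `[T₀]` lie in the target lattice. [folklore] -/
theorem single_rt_mem_target (Q : G) :
    Finsupp.single (rt c Q T₀) (1 : ℤ) ∈ (Submodule.span ℤ (pairSet c) ⊔ Submodule.span ℤ (translates c S)) ⊔
      Submodule.span ℤ (Set.range fun Q : G => Finsupp.single (rt c Q T₀) (1 : ℤ)) :=
  Submodule.mem_sup_right (Submodule.subset_span ⟨Q, rfl⟩)

/-- `[T₀]` itself lies in the target lattice. [folklore] -/
theorem single_base_mem_target :
    Finsupp.single T₀ (1 : ℤ) ∈ (Submodule.span ℤ (pairSet c) ⊔ Submodule.span ℤ (translates c S)) ⊔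
      Submodule.span ℤ (Set.range fun Q : G => Finsupp.single (rt c Q T₀) (1 : ℤ)) := by
  have h := single_rt_mem_target c S T₀ 1
  rwa [rt_one] at h

/-- Pairs lie in the target lattice. [folklore] -/
theorem pair_mem_target (Ψ : CMF G c) :
    pair c Ψ ∈ (Submodule.span ℤ (pairSet c) ⊔ Submodule.span ℤ (translates c S)) ⊔
      Submodule.span ℤ (Set.range fun Q : G => Finsupp.single (rt c Q T₀) (1 : ℤ)) :=
  Submodule.mem_sup_left (Submodule.mem_sup_left (Submodule.subset_span (pair_mem_pairSet c Ψ)))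

/-- Base changes of members of `S` lie in the target lattice. [folklore] -/
theorem mapDomain_rt_mem_target_of_mem (Q : G) {s : CMF G c →₀ ℤ} (hs : s ∈ S) :
    Finsupp.mapDomain (rt c Q) s ∈ (Submodule.span ℤ (pairSet c) ⊔ Submodule.span ℤ (translates c S)) ⊔
      Submodule.span ℤ (Set.range fun Q : G => Finsupp.single (rt c Q T₀) (1 : ℤ)) :=
  Submodule.mem_sup_left (Submodule.mem_sup_right (Submodule.subset_span ⟨Q, s, hs, rfl⟩))

/-- **The target lattice is base-change stable** (central `c`). [folklore] -/
theorem mapDomain_rt_mem_target (hcen : ∀ x : G, x * c = c * x) (Q : G) {y : CMF G c →₀ ℤ}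
    (hy : y ∈ (Submodule.span ℤ (pairSet c) ⊔ Submodule.span ℤ (translates c S)) ⊔
      Submodule.span ℤ (Set.range fun Q : G => Finsupp.single (rt c Q T₀) (1 : ℤ))) :
    Finsupp.mapDomain (rt c Q) y ∈ (Submodule.span ℤ (pairSet c) ⊔ Submodule.span ℤ (translates c S)) ⊔
      Submodule.span ℤ (Set.range fun Q : G => Finsupp.single (rt c Q T₀) (1 : ℤ)) := by
  obtain ⟨l, hl, b, hb, rfl⟩ := Submodule.mem_sup.mp hy
  rw [Finsupp.mapDomain_add]
  refine Submodule.add_mem _ (Submodule.mem_sup_left (mapDomain_rt_mem_psp c hcen Q S hl)) (Submodule.mem_sup_right ?_)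
  have hle : Submodule.map (Finsupp.lmapDomain ℤ ℤ (rt c Q)) (Submodule.span ℤ (Set.range fun Q : G => Finsupp.single (rt c Q T₀) (1 : ℤ))) ≤
      Submodule.span ℤ (Set.range fun Q : G => Finsupp.single (rt c Q T₀) (1 : ℤ)) := by
    rw [Submodule.map_span, Submodule.span_le]
    rintro _ ⟨_, ⟨Q', rfl⟩, rfl⟩
    rw [Finsupp.lmapDomain_apply, Finsupp.mapDomain_single, ← rt_mul]
    exact Submodule.subset_span ⟨Q * Q', rfl⟩
  exact hle (Submodule.mem_map_of_mem hb)

/-- **A reduction transports along the block**: `n[Ψ] ∈ 𝓣 ⟹ n[Ψ·Q⁻¹] ∈ 𝓣`. [folklore] -/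
theorem smul_single_rt_mem_target (hcen : ∀ x : G, x * c = c * x) (Q : G) (n : ℤ) {Ψ : CMF G c}
    (hΨ : n • Finsupp.single Ψ (1 : ℤ) ∈ (Submodule.span ℤ (pairSet c) ⊔ Submodule.span ℤ (translates c S)) ⊔
      Submodule.span ℤ (Set.range fun Q : G => Finsupp.single (rt c Q T₀) (1 : ℤ))) :
    n • Finsupp.single (rt c Q Ψ) (1 : ℤ) ∈ (Submodule.span ℤ (pairSet c) ⊔ Submodule.span ℤ (translates c S)) ⊔
      Submodule.span ℤ (Set.range fun Q : G => Finsupp.single (rt c Q T₀) (1 : ℤ)) := by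
  have h := mapDomain_rt_mem_target c S T₀ hcen Q hΨ
  rwa [Finsupp.mapDomain_smul, Finsupp.mapDomain_single] at h

/-- **It suffices to reduce one representative per residual block.**  If every residual type is a base change of a member of `Reps`, and every
member of `Reps` reduces up to `2^k`, then every residual type reduces up to `2^k`. [folklore] -/
theorem reduction_of_representatives (hcen : ∀ x : G, x * c = c * x) (Res Reps : Set (CMF G c)) (k : ℕ)
    (hcover : ∀ Ψ ∈ Res, ∃ Ψ₀ ∈ Reps, ∃ Q : G, Ψ = rt c Q Ψ₀)
    (hreps : ∀ Ψ₀ ∈ Reps, ((2 : ℤ) ^ k) • Finsupp.single Ψ₀ (1 : ℤ) ∈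
      (Submodule.span ℤ (pairSet c) ⊔ Submodule.span ℤ (translates c S)) ⊔
        Submodule.span ℤ (Set.range fun Q : G => Finsupp.single (rt c Q T₀) (1 : ℤ))) :
    ∀ Ψ ∈ Res, ((2 : ℤ) ^ k) • Finsupp.single Ψ (1 : ℤ) ∈
      (Submodule.span ℤ (pairSet c) ⊔ Submodule.span ℤ (translates c S)) ⊔
        Submodule.span ℤ (Set.range fun Q : G => Finsupp.single (rt c Q T₀) (1 : ℤ)) := by
  intro Ψ hΨ
  obtain ⟨Ψ₀, hΨ₀, Q, rfl⟩ := hcover Ψ hΨ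
  exact smul_single_rt_mem_target c S T₀ hcen Q _ (hreps Ψ₀ hΨ₀)

/-! ## §2 The order-four trick -/

/-- `Ψ·h⁻¹·h⁻¹ = Ψ·c⁻¹` when `h² = c`. [folklore] -/
theorem rt_rt_of_sq (h : G) (hh : h * h = c) (Ψ : CMF G c) : rt c h (rt c h Ψ) = rt c c Ψ := by
  rw [← rt_mul, hh]

/-- **THE ORDER-FOUR TRICK, `+` form**: `h² = c` and `n([Ψ] + [Ψ·h⁻¹]) ∈ 𝓣 ⟹ 2n[Ψ] ∈ 𝓣`.  (Base-change the relation along `h`: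
`n([Ψ·h⁻¹] + [Ψ̄]) ∈ 𝓣`; subtract and add the pair `n([Ψ] + [Ψ̄])`.) [folklore] -/
theorem two_mul_smul_single_mem_of_smul_add_mem (hcen : ∀ x : G, x * c = c * x) (h : G) (hh : h * h = c) (n : ℤ) (Ψ : CMF G c)
    (hrel : n • (Finsupp.single Ψ (1 : ℤ) + Finsupp.single (rt c h Ψ) 1) ∈
      (Submodule.span ℤ (pairSet c) ⊔ Submodule.span ℤ (translates c S)) ⊔
        Submodule.span ℤ (Set.range fun Q : G => Finsupp.single (rt c Q T₀) (1 : ℤ))) :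
    (2 * n) • Finsupp.single Ψ (1 : ℤ) ∈ (Submodule.span ℤ (pairSet c) ⊔ Submodule.span ℤ (translates c S)) ⊔
      Submodule.span ℤ (Set.range fun Q : G => Finsupp.single (rt c Q T₀) (1 : ℤ)) := by
  have h2 := mapDomain_rt_mem_target c S T₀ hcen h hrel
  rw [Finsupp.mapDomain_smul, Finsupp.mapDomain_add, Finsupp.mapDomain_single, Finsupp.mapDomain_single, rt_rt_of_sq c h hh] at h2
  have hp := Submodule.smul_mem _ n (pair_mem_target c S T₀ Ψ)
  have e : (2 * n) • Finsupp.single Ψ (1 : ℤ) =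
      n • (Finsupp.single Ψ (1 : ℤ) + Finsupp.single (rt c h Ψ) 1) - n • (Finsupp.single (rt c h Ψ) (1 : ℤ) + Finsupp.single (rt c c Ψ) 1) +
        n • pair c Ψ := by
    rw [pair, mul_smul, two_smul]
    simp only [smul_add]
    abel
  rw [e]
  exact Submodule.add_mem _ (Submodule.sub_mem _ hrel h2) hp

/-- **THE ORDER-FOUR TRICK, `−` form**: `h² = c` and `n([Ψ] − [Ψ·h⁻¹]) ∈ 𝓣 ⟹ 2n[Ψ] ∈ 𝓣`. [folklore] -/
theorem two_mul_smul_single_mem_of_smul_sub_mem (hcen : ∀ x : G, x * c = c * x) (h : G) (hh : h * h = c) (n : ℤ) (Ψ : CMF G c)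
    (hrel : n • (Finsupp.single Ψ (1 : ℤ) - Finsupp.single (rt c h Ψ) 1) ∈
      (Submodule.span ℤ (pairSet c) ⊔ Submodule.span ℤ (translates c S)) ⊔
        Submodule.span ℤ (Set.range fun Q : G => Finsupp.single (rt c Q T₀) (1 : ℤ))) :
    (2 * n) • Finsupp.single Ψ (1 : ℤ) ∈ (Submodule.span ℤ (pairSet c) ⊔ Submodule.span ℤ (translates c S)) ⊔
      Submodule.span ℤ (Set.range fun Q : G => Finsupp.single (rt c Q T₀) (1 : ℤ)) := by
  have h2 := mapDomain_rt_mem_target c S T₀ hcen h hrel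
  rw [Finsupp.mapDomain_smul, Finsupp.mapDomain_sub, Finsupp.mapDomain_single, Finsupp.mapDomain_single, rt_rt_of_sq c h hh] at h2
  have hp := Submodule.smul_mem _ n (pair_mem_target c S T₀ Ψ)
  have e : (2 * n) • Finsupp.single Ψ (1 : ℤ) =
      n • (Finsupp.single Ψ (1 : ℤ) - Finsupp.single (rt c h Ψ) 1) + n • (Finsupp.single (rt c h Ψ) (1 : ℤ) - Finsupp.single (rt c c Ψ) 1) +
        n • pair c Ψ := by
    rw [pair, mul_smul, two_smul]
    simp only [smul_add, smul_sub]
    abel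
  rw [e]
  exact Submodule.add_mem _ (Submodule.add_mem _ hrel h2) hp

/-- **The order-four trick one power up**: `h² = c`, `2^k([Ψ] + [Ψ·h⁻¹]) ∈ 𝓣 ⟹ 2^{k+1}[Ψ] ∈ 𝓣`. [folklore] -/
theorem pow_succ_smul_single_mem_of_smul_add_mem (hcen : ∀ x : G, x * c = c * x) (h : G) (hh : h * h = c) (k : ℕ) (Ψ : CMF G c)
    (hrel : ((2 : ℤ) ^ k) • (Finsupp.single Ψ (1 : ℤ) + Finsupp.single (rt c h Ψ) 1) ∈
      (Submodule.span ℤ (pairSet c) ⊔ Submodule.span ℤ (translates c S)) ⊔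
        Submodule.span ℤ (Set.range fun Q : G => Finsupp.single (rt c Q T₀) (1 : ℤ))) :
    ((2 : ℤ) ^ (k + 1)) • Finsupp.single Ψ (1 : ℤ) ∈ (Submodule.span ℤ (pairSet c) ⊔ Submodule.span ℤ (translates c S)) ⊔
      Submodule.span ℤ (Set.range fun Q : G => Finsupp.single (rt c Q T₀) (1 : ℤ)) := by
  rw [pow_succ, mul_comm]
  exact two_mul_smul_single_mem_of_smul_add_mem c S T₀ hcen h hh _ Ψ hrel

/-- **The order-four trick one power up, `−` form.** [folklore] -/
theorem pow_succ_smul_single_mem_of_smul_sub_mem (hcen : ∀ x : G, x * c = c * x) (h : G) (hh : h * h = c) (k : ℕ) (Ψ : CMF G c)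
    (hrel : ((2 : ℤ) ^ k) • (Finsupp.single Ψ (1 : ℤ) - Finsupp.single (rt c h Ψ) 1) ∈
      (Submodule.span ℤ (pairSet c) ⊔ Submodule.span ℤ (translates c S)) ⊔
        Submodule.span ℤ (Set.range fun Q : G => Finsupp.single (rt c Q T₀) (1 : ℤ))) :
    ((2 : ℤ) ^ (k + 1)) • Finsupp.single Ψ (1 : ℤ) ∈ (Submodule.span ℤ (pairSet c) ⊔ Submodule.span ℤ (translates c S)) ⊔
      Submodule.span ℤ (Set.range fun Q : G => Finsupp.single (rt c Q T₀) (1 : ℤ)) := by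
  rw [pow_succ, mul_comm]
  exact two_mul_smul_single_mem_of_smul_sub_mem c S T₀ hcen h hh _ Ψ hrel

end

end Summit.HodgeConjecture.CorCM.Census.Nondegenerate
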